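import Mathlib
import HarnessLib
import Literature.Analysis.FluidPDE.SuitableWeak
import Literature.Analysis.FluidPDE.SelfSimilar
import Literature.Analysis.FluidPDE.LocalTypeI
import Literature.Analysis.FluidPDE.SpaceTimeRescaling
import Literature.Analysis.FluidPDE.SuitableWeakRescaling
import Literature.Analysis.FluidPDE.LocalTypeIScaling

/-!
# Scaling covariance of the apex class (helper for `RellichScar.SimilarityCovariance`)

The apex class of route RellichScar — suitable weak solutions `(u, p)` of Navier–Stokes
(`ν = 1`, `f = 0`) on the slab `ℝ³ × (−∞, 0)` with a weak spatial gradient `G`, Albritton–Barker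
quantity `𝐈(ℝ³ × ℝ₋) < ∞`, the space–time Type-I bound `|u| ≤ C/(|x| + √−t)` and a backward
singular point at the origin — is invariant under the Navier–Stokes rescaling
`u ↦ λ u(λ² t, λ x)`, `p ↦ λ² p(λ² t, λ x)`, `G ↦ λ² G(λ² t, λ x)` (`λ > 0`), with the SAME `C`.
Pure bookkeeping over accepted tree lemmas: `IsSuitableWeakSolutionOn.stRescale`,
`HasWeakSpatialGradientOn.stRescale` (CKN 1982, §2 scaling), `typeIBound_lowerHalf_nsZoom`,
`eLpNorm_top_nsZoom` (Albritton–Barker 2019, §3), `HasTypeIDecay.nsRescale` (KNSS 2009, (1.6));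
the only work is the dictionary `nsRescale λ u = λ • stPull (λ²) λ 0 0 u` and the invariance of
the slab under the zoom about the origin.

Sources: L. Caffarelli, R. Kohn, L. Nirenberg, CPAM 35 (1982), §2; G. Koch, N. Nadirashvili,
G. Seregin, V. Šverák, Acta Math. 203 (2009), §1 (1.6); D. Albritton, T. Barker, JMFM 21 (2019), §3.
-/

-- the summit and its single sub-problem share the name (CONVENTIONS §1), as in every Theorems file
set_option linter.dupNamespace false

namespace Summit.NavierStokesRegularity.NavierStokesRegularity.Theorems.RellichScarSimilarityCovariance

open MeasureTheory Set Function Metric Filter TopologicalSpace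
open scoped ENNReal NNReal
open Literature.Analysis Literature.Analysis.FluidPDE

local notation "E³" => EuclideanSpace ℝ (Fin 3)

/-- The Navier–Stokes rescaling about the origin in the accepted `stPull` vocabulary:
`nsRescale λ u = λ • stPull (λ²) λ 0 0 u` (both are `(t, x) ↦ λ u(λ² t, λ x)`). -/
theorem nsRescale_eq_smul_stPull {F : Type*} [NormedAddCommGroup F] [NormedSpace ℝ F]
    (lam : ℝ) (u : ℝ → E³ → F) :
    nsRescale lam u = lam • stPull (lam ^ 2) lam 0 0 u := by
  funext t x
  simp only [nsRescale_apply, Pi.smul_apply, stPull_apply, zero_add]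

/-- The zoom about the origin maps the slab `ℝ³ × (−∞, 0)` onto itself:
`Φ⁻¹(slab) = slab` for `Φ(s, y) = (λ² s, λ y)`, `λ > 0`. -/
theorem stPreimage_slab_eq {lam : ℝ} (hlam : 0 < lam) :
    stPreimage (lam ^ 2) lam 0 (0 : E³) (slab E³ (Iio 0) isOpen_Iio) =
      slab E³ (Iio 0) isOpen_Iio := by
  ext z
  simp only [SetLike.mem_coe, mem_stPreimage, mem_slab, stAffine_fst, zero_add, mem_Iio]
  have h2 : 0 < lam ^ 2 := by positivity
  constructor
  · intro h
    by_contra hz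
    have : 0 ≤ lam ^ 2 * z.1 := mul_nonneg h2.le (not_lt.1 hz)
    linarith
  · intro h
    exact mul_neg_of_pos_of_neg h2 h

/-- **Scaling covariance of the suitable weak class on the slab** (CKN 1982, §2): if `(u, p)` is
a suitable weak solution (`ν = 1`, `f = 0`) on `ℝ³ × (−∞, 0)`, then so is
`(λ u(λ²t, λx), λ² p(λ²t, λx))` for every `λ > 0`. -/
theorem isSuitableWeakSolutionOn_nsRescale {u : ℝ → E³ → E³} {p : ℝ → E³ → ℝ}
    (h : IsSuitableWeakSolutionOn (slab E³ (Iio 0) isOpen_Iio) 1 0 u p) {lam : ℝ}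
    (hlam : 0 < lam) :
    IsSuitableWeakSolutionOn (slab E³ (Iio 0) isOpen_Iio) 1 0 (nsRescale lam u)
      (lam ^ 2 • stPull (lam ^ 2) lam 0 0 p) := by
  have key := h.stRescale (α := lam) (β := lam ^ 2) (γ := lam) hlam hlam (by ring) 0 (0 : E³)
  rw [stPreimage_slab_eq hlam] at key
  have hν : lam * 1 / lam = 1 := by field_simp
  have hf : ((lam ^ 2 * lam) • stPull (lam ^ 2) lam 0 (0 : E³) (0 : ℝ → E³ → E³)) = 0 := by
    funext t x
    simp only [Pi.smul_apply, stPull_apply, Pi.zero_apply, smul_zero]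
  rw [hν, hf] at key
  rw [nsRescale_eq_smul_stPull]
  exact key

/-- **Scaling covariance of weak spatial gradients on the slab**: if `G` is a weak spatial
gradient of `u` on `ℝ³ × (−∞, 0)`, then `λ² G(λ²t, λx)` is one of `λ u(λ²t, λx)`. -/
theorem hasWeakSpatialGradientOn_nsRescale {u : ℝ → E³ → E³} {G : ℝ → E³ → E³ →L[ℝ] E³}
    (h : HasWeakSpatialGradientOn (slab E³ (Iio 0) isOpen_Iio) u G) {lam : ℝ} (hlam : 0 < lam) :
    HasWeakSpatialGradientOn (slab E³ (Iio 0) isOpen_Iio) (nsRescale lam u)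
      (lam ^ 2 • stPull (lam ^ 2) lam 0 0 G) := by
  have key := h.stRescale lam (β := lam ^ 2) (γ := lam) (by positivity) hlam 0 (0 : E³)
  rw [stPreimage_slab_eq hlam, show lam * lam = lam ^ 2 by ring] at key
  rw [nsRescale_eq_smul_stPull]
  exact key

/-- **Scale invariance of `𝐈(ℝ³ × ℝ₋)`** (Albritton–Barker 2019, §3): the Type-I quantity of the
rescaled triple equals that of `(u, p, G)`. -/
theorem typeIBound_nsRescale (u : ℝ → E³ → E³) (p : ℝ → E³ → ℝ) (G : ℝ → E³ → E³ →L[ℝ] E³)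
    {lam : ℝ} (hlam : 0 < lam) :
    typeIBound (Iio (0 : ℝ) ×ˢ univ) (nsRescale lam u) (lam ^ 2 • stPull (lam ^ 2) lam 0 0 p)
        (lam ^ 2 • stPull (lam ^ 2) lam 0 0 G) =
      typeIBound (Iio (0 : ℝ) ×ˢ univ) u p G := by
  rw [nsRescale_eq_smul_stPull]
  exact typeIBound_lowerHalf_nsZoom hlam u p G

/-- **The origin stays singular under rescaling**: `‖u_λ‖_{L^∞(Q(0, r))} = λ ‖u‖_{L^∞(Q(0, λ r))}`
(A–B 2019, §3), so a backward singular point of `u` at the origin is one of `u_λ`. -/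
theorem isBackwardSingularPoint_nsRescale {u : ℝ → E³ → E³} (h : IsBackwardSingularPoint u 0)
    {lam : ℝ} (hlam : 0 < lam) : IsBackwardSingularPoint (nsRescale lam u) 0 := by
  intro r hr
  rw [nsRescale_eq_smul_stPull, eLpNorm_top_nsZoom hlam 0 (0 : E³) r 0 u]
  have h0 : stAffine (lam ^ 2) lam 0 (0 : E³) 0 = 0 := by
    simp [stAffine, Prod.ext_iff]
  rw [h0, h (lam * r) (mul_pos hlam hr)]
  exact ENNReal.mul_top (by simpa using hlam)

/-- **Scaling half of `SimilarityCovariance`**: the apex class with constant `C` and the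
singularity of the origin are invariant under `u ↦ λ u(λ² t, λ x)` (`λ > 0`), with pressure
`λ² p(λ² t, λ x)` and gradient `λ² G(λ² t, λ x)`. -/
theorem apexClass_nsRescale {u : ℝ → E³ → E³} {p : ℝ → E³ → ℝ} {G : ℝ → E³ → E³ →L[ℝ] E³}
    {C : ℝ} (hsw : IsSuitableWeakSolutionOn (slab E³ (Iio 0) isOpen_Iio) 1 0 u p)
    (hG : HasWeakSpatialGradientOn (slab E³ (Iio 0) isOpen_Iio) u G)
    (hI : typeIBound (Iio (0 : ℝ) ×ˢ univ) u p G < ⊤) (hC : HasTypeIDecay C u)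
    (hsing : IsBackwardSingularPoint u 0) {lam : ℝ} (hlam : 0 < lam) :
    ∃ (q : ℝ → E³ → ℝ) (H : ℝ → E³ → E³ →L[ℝ] E³),
      IsSuitableWeakSolutionOn (slab E³ (Iio 0) isOpen_Iio) 1 0 (nsRescale lam u) q ∧
      HasWeakSpatialGradientOn (slab E³ (Iio 0) isOpen_Iio) (nsRescale lam u) H ∧
      typeIBound (Iio (0 : ℝ) ×ˢ univ) (nsRescale lam u) q H < ⊤ ∧
      HasTypeIDecay C (nsRescale lam u) ∧ IsBackwardSingularPoint (nsRescale lam u) 0 :=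
  ⟨lam ^ 2 • stPull (lam ^ 2) lam 0 0 p, lam ^ 2 • stPull (lam ^ 2) lam 0 0 G,
    isSuitableWeakSolutionOn_nsRescale hsw hlam, hasWeakSpatialGradientOn_nsRescale hG hlam,
    by rwa [typeIBound_nsRescale u p G hlam], hC.nsRescale hlam,
    isBackwardSingularPoint_nsRescale hsing hlam⟩

end Summit.NavierStokesRegularity.NavierStokesRegularity.Theorems.RellichScarSimilarityCovariance
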